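import Summits.CriticalPhenomena.PercolationContinuityZ3.Theorems.PercNearOneGluingNoHeavyLowerTailAPLLadderApex
import HarnessLib

/-!
# `NoHeavyLowerTail` (stmt-CriticalPhenomena-4575) — LADDER NETWORKS IV: `28/27` IS SHARP IN THE SERIES–PARALLEL THEOREM
# (`sup E = 28/27` over two-terminal series–parallel apex networks, approached by balanced apex ladders)

Support file (prover prim-ineq-gen-8 gen 61; `--supports stmt-CriticalPhenomena-4575`; memo
run/shared/lean/prim/prim-ineq-gen-8/FINDING-gen61-SPTHEOREM.md §2).  No definitions, no named facts, no sorries.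

Setting of `…APLLadderCells` / `…APLLadderNumbers` / `…APLLadderApex`: the balanced ladder `L n` on `z 0, …, z(2n+2)` (seed path
`z1 — z0 — z2` of weight `2/3`; per round a rung of weight `w` between the ports and two rails of weight `c = (3+w)/(3(1+w))` to the new
ports), the apex `o` hung at `z 0` by one edge of weight `ε`, ports `u = z(2n+1)`, `v = z(2n+2)`; `E = κ²/(pπm)` for `(o; u, v)`.
* `ladder_iterate` — `s_n = s* + ρⁿ(s₀ − s*)` for `s ↦ c²(s + w(1−s))` (`ρ = c²(1−w)`, `s* = c²w/(1−ρ)`);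
* `ladder_weights` — the weights in the parameter `t ∈ (0, 1/4]`: `w = 3t/(1−t)`, `c = 1/(1+2t)` satisfy `c = (3+w)/(3(1+w))`,
  `λ = c²(1+w) = 1/((1−t)(1+2t)) ∈ (0,1]`, `ρ ∈ [0,1)`, and `s* = 3/(7 − 4t²)` — so the core limit is `E* = 4/(9s*) = 28/27 − (16/27)t²`;
* `ladder_arith` — the final estimate: with `t ≤ δ`, `ρⁿ ≤ t/4`, apex weight `ε = t/16`, the apex ladder has `pπm > 0` and
  `(28/27 − δ)·pπm < κ²`;
* **`ladder_sharp`** (every vertex set with `2n+4` points) and **`sp_E_le_sharp`** (on `Fin N`) — THE SHARPNESS THEOREM: for every `δ > 0`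
  there is an explicit two-terminal series–parallel apex network (`GZSP.IsSPNet`, a balanced apex ladder) with weights in `[0,1]`,
  `pπm > 0` and `(28/27 − δ)·P(u ∈ cl o)P(v ∈ cl o)P(u ∉ cl o, v ∈ cl u) < (P(u,v ∈ cl o) − P(u ∈ cl o)P(v ∈ cl o))²`, i.e. `E > 28/27 − δ`.
  With `sp_E_le` (`…APLSeriesParallel`, `E ≤ 28/27` on the whole class): **`sup E = 28/27` EXACTLY over two-terminal series–parallel apex
  networks** (`sp_E_le` bounds every network of the class by `28/27`; the ladders approach it).  (Bead chains: `E ≤ 1`, `beadChain_E_le_one`.  One-sided towers of triangles stop at `≈ 1.0316`; the alternation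
  of the two rails is what reaches `28/27`: in the weak-apex continuum limit `d log E/dη = (h(θ) − E)/θ²` along shortcut time `η` at shape
  `θ = τ/p`, `h(θ) = 4θ − 5θ² + 2θ³`, `max_θ h = h(2/3) = 28/27` — memo gen 61 §2.)
[this work]
-/

namespace Summit.CriticalPhenomena.PercolationContinuityZ3.Theorems

namespace APL

open Literature.Probability.Percolation Literature.Probability.Percolation.Gladkov Literature.Probability.Percolation.DecisionTree
open scoped Classical

variable {V : Type*} [Fintype V]

/-! ### Real analysis of the balanced recursion -/

/-- Closed form of the affine recursion `s ↦ c²(s + w(1 − s))`: `s_n = s* + ρⁿ(s₀ − s*)`, `ρ = c²(1−w)`, `s* = c²w/(1−ρ)`. [folklore] -/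
theorem ladder_iterate (c w s0 : ℝ) (h : 1 - c ^ 2 * (1 - w) ≠ 0) (n : ℕ) :
    (fun s : ℝ => c ^ 2 * (s + w * (1 - s)))^[n] s0
      = c ^ 2 * w / (1 - c ^ 2 * (1 - w)) + (c ^ 2 * (1 - w)) ^ n * (s0 - c ^ 2 * w / (1 - c ^ 2 * (1 - w))) := by
  induction n with
  | zero => simp
  | succ n ih =>
    rw [Function.iterate_succ_apply', ih, pow_succ]
    field_simp
    ring

/-- **The balanced weights in the parameter `t ∈ (0, 1/4]`**: rung `w = 3t/(1−t)`, rail `c = 1/(1+2t)`; then `c = (3+w)/(3(1+w))`,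
`λ = c²(1+w) = 1/((1−t)(1+2t)) ∈ (0,1]`, `ρ = c²(1−w) ∈ [0,1)`, and the fixed point is `s* = 3/(7 − 4t²)` (so the core limit is
`E* = 4/(9s*) = 28/27 − 16t²/27`). [this work] -/
theorem ladder_weights (t : ℝ) (ht0 : 0 < t) (ht4 : t ≤ 1 / 4) :
    let w := 3 * t / (1 - t)
    let c := 1 / (1 + 2 * t)
    c = (3 + w) / (3 * (1 + w)) ∧ 0 < w ∧ w ≤ 1 ∧ 0 < c ∧ c ≤ 1
    ∧ c ^ 2 * (1 + w) = 1 / ((1 - t) * (1 + 2 * t)) ∧ 0 < c ^ 2 * (1 + w) ∧ c ^ 2 * (1 + w) ≤ 1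
    ∧ 0 ≤ c ^ 2 * (1 - w) ∧ c ^ 2 * (1 - w) < 1 ∧ 1 - c ^ 2 * (1 - w) ≠ 0
    ∧ c ^ 2 * w / (1 - c ^ 2 * (1 - w)) * (7 - 4 * t ^ 2) = 3 := by
  intro w c
  have h1t : 0 < 1 - t := by linarith
  have h2t : 0 < 1 + 2 * t := by linarith
  have hw0 : 0 < w := div_pos (by linarith) h1t
  have hw1 : w ≤ 1 := by rw [div_le_one h1t]; linarith
  have hc0 : 0 < c := div_pos one_pos h2t
  have hc1 : c ≤ 1 := by rw [div_le_one h2t]; linarith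
  have hcw : c = (3 + w) / (3 * (1 + w)) := by
    simp only [w, c]; field_simp; ring
  have hlam : c ^ 2 * (1 + w) = 1 / ((1 - t) * (1 + 2 * t)) := by
    simp only [w, c]; field_simp; ring
  have hrho : c ^ 2 * (1 - w) = (1 - 4 * t) / ((1 - t) * (1 + 2 * t) ^ 2) := by
    simp only [w, c]; field_simp; ring
  have hden : 1 ≤ (1 - t) * (1 + 2 * t) := by nlinarith
  have hden2 : 1 ≤ (1 - t) * (1 + 2 * t) ^ 2 := by nlinarith
  refine ⟨hcw, hw0, hw1, hc0, hc1, hlam, by rw [hlam]; positivity, ?_, ?_, ?_, ?_, ?_⟩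
  · rw [hlam, div_le_one (by positivity)]; exact hden
  · rw [hrho]; exact div_nonneg (by linarith) (by positivity)
  · rw [hrho, div_lt_one (by positivity)]; linarith
  · rw [hrho]; intro h
    have : (1 - 4 * t) / ((1 - t) * (1 + 2 * t) ^ 2) = 1 := by linarith
    rw [div_eq_one_iff_eq (by positivity)] at this
    nlinarith
  · have hne' : 1 - c ^ 2 * (1 - w) = t * (7 - 4 * t ^ 2) / ((1 - t) * (1 + 2 * t) ^ 2) := by
      simp only [w, c]; field_simp; ring
    have ht : t ≠ 0 := ht0.ne'
    have h7 : 7 - 4 * t ^ 2 ≠ 0 := by nlinarith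
    have h7' : 7 - t ^ 2 * 4 ≠ 0 := by nlinarith
    rw [hne']
    simp only [w, c]
    field_simp

/-- **The arithmetic of sharpness.**  With `t ≤ min(δ, 1/4)`, `R = ρⁿ ≤ t/4`, `Λ = λⁿ ∈ (0,1]`, apex weight `ε = t/16` and the fixed point
`S = 3/(7−4t²)`, the numbers `p = π = ε(2/3)Λ`, `τ = ε(4/9)Λ`, `m = S + R(4/9 − S) − ε(4/9)Λ` of the apex ladder satisfy `pπm > 0` and
`(28/27 − δ)·pπm < (τ − pπ)²`, i.e. `E > 28/27 − δ`. [this work] -/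
theorem ladder_arith (δ t R Λ ε S : ℝ) (hδ : 0 < δ) (ht0 : 0 < t) (htδ : t ≤ δ) (ht4 : t ≤ 1 / 4)
    (hR0 : 0 ≤ R) (hR : R ≤ t / 4) (hΛ0 : 0 < Λ) (hΛ1 : Λ ≤ 1) (hε : ε = t / 16) (hS : S * (7 - 4 * t ^ 2) = 3) :
    0 < (ε * (2 / 3 * Λ)) * (ε * (2 / 3 * Λ)) * ((S + R * (4 / 9 - S)) - ε * (4 / 9 * Λ))
    ∧ (28 / 27 - δ) * ((ε * (2 / 3 * Λ)) * (ε * (2 / 3 * Λ)) * ((S + R * (4 / 9 - S)) - ε * (4 / 9 * Λ)))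
        < (ε * (4 / 9 * Λ) - (ε * (2 / 3 * Λ)) * (ε * (2 / 3 * Λ))) ^ 2 := by
  have hD : 0 < 7 - 4 * t ^ 2 := by nlinarith
  have hS0 : 3 / 7 ≤ S := by
    by_contra h
    have h' := not_le.mp h
    nlinarith
  have hS1 : S ≤ 1 / 2 := by
    by_contra h
    have h' := not_le.mp h
    nlinarith
  have hε0 : 0 < ε := by rw [hε]; positivity
  have hεΛ : ε * Λ ≤ 1 / 64 := by rw [hε]; nlinarith
  have hR1 : R ≤ 1 / 16 := by linarith
  have hsn : 3 / 7 - 1 / 16 ≤ S + R * (4 / 9 - S) := by nlinarith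
  have hm : 0 < (S + R * (4 / 9 - S)) - ε * (4 / 9 * Λ) := by nlinarith
  refine ⟨by positivity, ?_⟩
  have hAS : (28 / 27 - δ) * S ≤ 4 / 9 * (1 - δ / 2) := by
    have key : (28 / 27 - δ) * S * (7 - 4 * t ^ 2) ≤ 4 / 9 * (1 - δ / 2) * (7 - 4 * t ^ 2) := by
      rw [mul_assoc, hS]
      nlinarith [mul_le_mul_of_nonneg_left ht4 ht0.le]
    exact le_of_mul_le_mul_right key hD
  by_cases hA : 0 < 28 / 27 - δ
  · have hred : (28 / 27 - δ) * ((S + R * (4 / 9 - S)) - ε * (4 / 9 * Λ)) < 4 / 9 * (1 - ε * Λ) ^ 2 := by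
      have h1 : (28 / 27 - δ) * ((S + R * (4 / 9 - S)) - ε * (4 / 9 * Λ)) ≤ (28 / 27 - δ) * (S + R * (4 / 9)) := by
        apply mul_le_mul_of_nonneg_left _ hA.le
        nlinarith [mul_nonneg hR0 (show (0:ℝ) ≤ S by linarith)]
      have h2 : (28 / 27 - δ) * (R * (4 / 9)) ≤ 28 / 27 * (t / 4) * (4 / 9) := by nlinarith
      have h3 : 4 / 9 * (1 - 2 * (ε * Λ)) ≤ 4 / 9 * (1 - ε * Λ) ^ 2 := by nlinarith [sq_nonneg (ε * Λ)]
      have h4 : ε * Λ ≤ t / 16 := by rw [hε]; nlinarith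
      nlinarith
    have hpos : 0 < (ε * Λ) ^ 2 := by positivity
    nlinarith [mul_lt_mul_of_pos_left hred hpos]
  · have hA' := not_lt.mp hA
    have hpos : 0 < (ε * (4 / 9 * Λ) - (ε * (2 / 3 * Λ)) * (ε * (2 / 3 * Λ))) ^ 2 := by
      have e : ε * (4 / 9 * Λ) - (ε * (2 / 3 * Λ)) * (ε * (2 / 3 * Λ)) = 4 / 9 * (ε * Λ) * (1 - ε * Λ) := by ring
      have h1 : 0 < 1 - ε * Λ := by linarith
      rw [e]
      positivity
    have hnonpos : (28 / 27 - δ) * ((ε * (2 / 3 * Λ)) * (ε * (2 / 3 * Λ)) * ((S + R * (4 / 9 - S)) - ε * (4 / 9 * Λ))) ≤ 0 :=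
      mul_nonpos_of_nonpos_of_nonneg hA' (by positivity)
    linarith

/-! ### Sharpness of `28/27` -/

/-- **`28/27` IS SHARP IN THE SERIES–PARALLEL THEOREM** (ladder form).  For every `δ > 0` there is `n` such that in every finite vertex set
containing `2n+3` distinct vertices `z 0, …, z (2n+2)` and an apex `o`, the balanced apex ladder of `n` rounds (core `L n`, apex edge
`s(o, z 0)` of weight `t/16`, seeds `2/3`, rungs `3t/(1−t)`, rails `1/(1+2t)`, `t = min(δ, 1/4)`) is a two-terminal series–parallel apex
network (`GZSP.IsSPNet`, ports `z(2n+1), z(2n+2)`) with `E = κ²/(pπm) > 28/27 − δ` (`pπm > 0`):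
`(28/27 − δ)·P(u ∈ cl o)P(v ∈ cl o)P(u ∉ cl o, v ∈ cl u) < (P(u,v ∈ cl o) − P(u ∈ cl o)P(v ∈ cl o))²`. [this work] -/
theorem ladder_sharp (δ : ℝ) (hδ : 0 < δ) :
    ∃ n : ℕ, ∀ {W : Type*} [Fintype W] (z : ℕ → W) (o : W),
      (∀ i j, i ≤ 2 * n + 2 → j ≤ 2 * n + 2 → z i = z j → i = j) → (∀ j, j ≤ 2 * n + 2 → z j ≠ o) →
      ∃ (p : Sym2 W → ℝ) (E : Finset (Sym2 W)), (∀ e, 0 ≤ p e ∧ p e ≤ 1)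
        ∧ GZSP.IsSPNet o E (z (2 * n + 1)) (z (2 * n + 2))
        ∧ 0 < PrW E p {K : Finset (Sym2 W) | z (2 * n + 1) ∈ cl K o} * PrW E p {K : Finset (Sym2 W) | z (2 * n + 2) ∈ cl K o}
              * PrW E p {K : Finset (Sym2 W) | z (2 * n + 1) ∉ cl K o ∧ z (2 * n + 2) ∈ cl K (z (2 * n + 1))}
        ∧ (28 / 27 - δ) * (PrW E p {K : Finset (Sym2 W) | z (2 * n + 1) ∈ cl K o} * PrW E p {K : Finset (Sym2 W) | z (2 * n + 2) ∈ cl K o}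
              * PrW E p {K : Finset (Sym2 W) | z (2 * n + 1) ∉ cl K o ∧ z (2 * n + 2) ∈ cl K (z (2 * n + 1))})
            < (PrW E p {K : Finset (Sym2 W) | z (2 * n + 1) ∈ cl K o ∧ z (2 * n + 2) ∈ cl K o}
                - PrW E p {K : Finset (Sym2 W) | z (2 * n + 1) ∈ cl K o} * PrW E p {K : Finset (Sym2 W) | z (2 * n + 2) ∈ cl K o}) ^ 2 := by
  -- the parameters
  obtain ⟨t, ht0, htδ, ht4⟩ : ∃ t : ℝ, 0 < t ∧ t ≤ δ ∧ t ≤ 1 / 4 := ⟨min δ (1 / 4), lt_min hδ (by norm_num), min_le_left _ _, min_le_right _ _⟩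
  obtain ⟨hcw, hw0, hw1, hc0, hc1, -, hl0, hl1, hr0, hr1, hne, hS⟩ := ladder_weights t ht0 ht4
  set w : ℝ := 3 * t / (1 - t) with hw_def
  set c : ℝ := 1 / (1 + 2 * t) with hc_def
  obtain ⟨n, hn⟩ := exists_pow_lt_of_lt_one (show 0 < t / 4 by positivity) hr1
  refine ⟨n, fun {W} _ z o hz ho => ?_⟩
  -- the ladder
  let L : ℕ → Finset (Sym2 W) := fun k => Nat.rec (({s(z 0, z 1)} : Finset (Sym2 W)) ∪ {s(z 0, z 2)})
    (fun r Lr => (({s(z (2 * r + 3), z (2 * r + 1))} : Finset (Sym2 W)) ∪ (Lr ∪ {s(z (2 * r + 1), z (2 * r + 2))}))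
      ∪ {s(z (2 * r + 4), z (2 * r + 2))}) k
  have hL0 : L 0 = {s(z 0, z 1)} ∪ {s(z 0, z 2)} := rfl
  have hLs : ∀ r : ℕ, L (r + 1) = ({s(z (2 * r + 3), z (2 * r + 1))} ∪ (L r ∪ {s(z (2 * r + 1), z (2 * r + 2))}))
      ∪ {s(z (2 * r + 4), z (2 * r + 2))} := fun r => rfl
  -- the weights
  let p : Sym2 W → ℝ := fun e =>
    if o ∈ e then t / 16 else if z 0 ∈ e then 2 / 3 else if ∃ r, r < n ∧ e = s(z (2 * r + 1), z (2 * r + 2)) then w else c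
  have hp01 : ∀ e, 0 ≤ p e ∧ p e ≤ 1 := by
    intro e
    simp only [p]
    split_ifs
    · constructor <;> linarith
    · norm_num
    · exact ⟨hw0.le, hw1⟩
    · exact ⟨hc0.le, hc1⟩
  have hpo : p s(o, z 0) = t / 16 := by simp only [p, if_pos (Sym2.mem_mk_left o (z 0))]
  have hzo : ∀ i j, i ≤ 2 * n + 2 → j ≤ 2 * n + 2 → o ∉ s(z i, z j) := fun i j hi hj h => by
    rcases Sym2.mem_iff.1 h with h | h
    · exact ho i hi h.symm
    · exact ho j hj h.symm
  have hz0 : ∀ i j, i ≤ 2 * n + 2 → j ≤ 2 * n + 2 → 0 < i → 0 < j → z 0 ∉ s(z i, z j) := fun i j hi hj hi0 hj0 h => by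
    rcases Sym2.mem_iff.1 h with h | h
    · have := hz 0 i (by omega) hi h; omega
    · have := hz 0 j (by omega) hj h; omega
  have h01 : p s(z 0, z 1) = 2 / 3 := by
    simp only [p, if_neg (hzo 0 1 (by omega) (by omega)), if_pos (Sym2.mem_mk_left (z 0) (z 1))]
  have h02 : p s(z 0, z 2) = 2 / 3 := by
    simp only [p, if_neg (hzo 0 2 (by omega) (by omega)), if_pos (Sym2.mem_mk_left (z 0) (z 2))]
  have hrung : ∀ r, r < n → p s(z (2 * r + 1), z (2 * r + 2)) = w := fun r hr => by
    simp only [p, if_neg (hzo (2 * r + 1) (2 * r + 2) (by omega) (by omega)),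
      if_neg (hz0 (2 * r + 1) (2 * r + 2) (by omega) (by omega) (by omega) (by omega))]
    rw [if_pos ⟨r, hr, rfl⟩]
  have hrail : ∀ r, r < n → p s(z (2 * r + 3), z (2 * r + 1)) = c ∧ p s(z (2 * r + 4), z (2 * r + 2)) = c := fun r hr => by
    constructor
    · simp only [p, if_neg (hzo (2 * r + 3) (2 * r + 1) (by omega) (by omega)),
        if_neg (hz0 (2 * r + 3) (2 * r + 1) (by omega) (by omega) (by omega) (by omega))]
      rw [if_neg]
      rintro ⟨r', hr', h⟩
      rcases Sym2.eq_iff.1 h with ⟨h1, h2⟩ | ⟨h1, h2⟩ <;>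
      · have := hz _ _ (by omega) (by omega) h1
        have := hz _ _ (by omega) (by omega) h2
        omega
    · simp only [p, if_neg (hzo (2 * r + 4) (2 * r + 2) (by omega) (by omega)),
        if_neg (hz0 (2 * r + 4) (2 * r + 2) (by omega) (by omega) (by omega) (by omega))]
      rw [if_neg]
      rintro ⟨r', hr', h⟩
      rcases Sym2.eq_iff.1 h with ⟨h1, h2⟩ | ⟨h1, h2⟩ <;>
      · have := hz _ _ (by omega) (by omega) h1
        have := hz _ _ (by omega) (by omega) h2
        omega
  -- the numbers of the core and of the apex ladder
  obtain ⟨np, nπ, nτ, nm⟩ := ladder_numbers z L hL0 hLs p w c hcw hw0.le h01 h02 n hrung hrail hz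
  have hsp := ladder_isSPNet z L o hL0 hLs n hz ho
  have hg1 : z (2 * n + 1) ≠ o := ho _ (by omega)
  have hg2 : z (2 * n + 2) ≠ o := ho _ (by omega)
  have hR : ∀ f ∈ L n, o ∉ f := fun f hf hof => by
    obtain ⟨j, hj, h⟩ := ladder_vertex z L hL0 hLs n hf hof
    exact ho j hj h.symm
  obtain ⟨ap, aπ, aτ, am⟩ := pendant_apex_numbers p (L n) o (z 0) (z (2 * n + 1)) (z (2 * n + 2)) (ho 0 (by omega)).symm hg1 hg2 hR
  rw [np, hpo] at ap
  rw [nπ, hpo] at aπ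
  rw [nτ, hpo] at aτ
  rw [nm, nτ, hpo, ladder_iterate c w (4 / 9) hne n] at am
  refine ⟨p, insert s(o, z 0) (L n), hp01, hsp, ?_⟩
  rw [ap, aπ, aτ, am]
  have key := ladder_arith δ t ((c ^ 2 * (1 - w)) ^ n) ((c ^ 2 * (1 + w)) ^ n) (t / 16) (c ^ 2 * w / (1 - c ^ 2 * (1 - w)))
    hδ ht0 htδ ht4 (pow_nonneg hr0 n) hn.le (pow_pos hl0 n) (pow_le_one₀ hl0.le hl1) rfl hS
  refine ⟨?_, ?_⟩
  · convert key.1 using 1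
    ring
  · convert key.2 using 1
    all_goals ring

/-- **`28/27` IS SHARP IN THE SERIES–PARALLEL THEOREM** (concrete form).  For every `δ > 0` there is an explicit finite weighted graph — a
two-terminal series–parallel apex network `GZSP.IsSPNet o E u v` on `Fin N` (a ladder with a pendant apex) with weights in `[0,1]` — whose
three-point ratio exceeds `28/27 − δ`: `(28/27 − δ)·P(u ∈ cl o)·P(v ∈ cl o)·P(u ∉ cl o, v ∈ cl u) < (P(u,v ∈ cl o) − P(u ∈ cl o)P(v ∈ cl o))²`
with `P(u ∈ cl o)P(v ∈ cl o)P(u ∉ cl o, v ∈ cl u) > 0`.  Hence `sup E = 28/27` exactly on the class of `sp_E_le`. [this work] -/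
theorem sp_E_le_sharp (δ : ℝ) (hδ : 0 < δ) :
    ∃ (N : ℕ) (p : Sym2 (Fin N) → ℝ) (o u v : Fin N) (E : Finset (Sym2 (Fin N))), (∀ e, 0 ≤ p e ∧ p e ≤ 1)
      ∧ GZSP.IsSPNet o E u v
      ∧ 0 < PrW E p {K : Finset (Sym2 (Fin N)) | u ∈ cl K o} * PrW E p {K : Finset (Sym2 (Fin N)) | v ∈ cl K o}
            * PrW E p {K : Finset (Sym2 (Fin N)) | u ∉ cl K o ∧ v ∈ cl K u}
      ∧ (28 / 27 - δ) * (PrW E p {K : Finset (Sym2 (Fin N)) | u ∈ cl K o} * PrW E p {K : Finset (Sym2 (Fin N)) | v ∈ cl K o}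
            * PrW E p {K : Finset (Sym2 (Fin N)) | u ∉ cl K o ∧ v ∈ cl K u})
          < (PrW E p {K : Finset (Sym2 (Fin N)) | u ∈ cl K o ∧ v ∈ cl K o}
              - PrW E p {K : Finset (Sym2 (Fin N)) | u ∈ cl K o} * PrW E p {K : Finset (Sym2 (Fin N)) | v ∈ cl K o}) ^ 2 := by
  obtain ⟨n, h⟩ := ladder_sharp δ hδ
  let z : ℕ → Fin (2 * n + 4) := fun j => if hj : j < 2 * n + 4 then ⟨j, hj⟩ else ⟨0, by omega⟩
  have hz : ∀ i j, i ≤ 2 * n + 2 → j ≤ 2 * n + 2 → z i = z j → i = j := fun i j hi hj hij => by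
    simp only [z, dif_pos (show i < 2 * n + 4 by omega), dif_pos (show j < 2 * n + 4 by omega), Fin.mk.injEq] at hij
    exact hij
  have ho : ∀ j, j ≤ 2 * n + 2 → z j ≠ (⟨2 * n + 3, by omega⟩ : Fin (2 * n + 4)) := fun j hj hj' => by
    simp only [z, dif_pos (show j < 2 * n + 4 by omega), Fin.mk.injEq] at hj'
    omega
  obtain ⟨p, E, h1, h2, h3, h4⟩ := h z ⟨2 * n + 3, by omega⟩ hz ho
  refine ⟨2 * n + 4, p, ⟨2 * n + 3, by omega⟩, z (2 * n + 1), z (2 * n + 2), E, h1, h2, ?_, ?_⟩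
  · convert h3
  · convert h4

end APL

end Summit.CriticalPhenomena.PercolationContinuityZ3.Theorems
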